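import Mathlib
import HarnessLib
import HarnessLib.Audit
import Summits.ResolutionOfSingularities.Statement
import HarnessLib.Audit.Status.Attr

/-!
Route: ToddIndex

DORMANT since 2026-08-24T19:39:41Z (reconciler: no traction for 7 d (last activity statement-grounded at 2026-08-17T18:38:52Z); parked, not closed — `ledger route dormant route-ResolutionOfSingularities-ToddIndex --off` to reactivate) — unstaffed, not closed; items shared with open routes are served there. `ledger route dormant <id> --off` reactivates.

# Route ToddIndex — Todd denominators bound the p-index — one integrality violator refutes
resolution in characteristic p

REFUTATION-SHAPED certificate route (operator computational-witness). It suffices, to REFUTE the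
summit, to exhibit ONE embedded integral
projective variety X = Proj(k[x_0..x_N]/I) over a field k of some prime characteristic p that
violates HAUTION'S TODD–INDEX BOUND
v_p(n_X) ≤ ⌊dim X/(p−1)⌋ + v_p(χ(X,O_X)) (n_X = index = gcd of closed-point degrees; Haution, Adv.
Math. 231 (2012) = arXiv:1103.4084,
Prop. 12 / Statement 1), typed scheme-free: Hilbert function m ↦ dim_k (S/I)_m, Hilbert polynomial P
(dim X = deg P, χ(O_X) = P(0)),
point degrees through non-zero zeros of I over finite extensions L/k. X = W ∧ D with W =
NotToddIndexBound (crux 2, THE CERTIFICATE: a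
violator exists) and D = ResolutionToToddIndex (crux 3, THE BRIDGE: the summit plus
Riemann–Roch-without-denominators for regular
projective varieties (support RegularModelsToddIndex, known) imply the bound in every prime
characteristic — Haution's Thm 3.1 with
alteration degree λ = 1, by dévissage on G_0 and induction on dimension). No idea card is realised
(none uses index / Riemann–Roch).
Lean: `(let hilb : (k : Type) → [Field k] → (N : ℕ) → Ideal (MvPolynomial (Fin (N + 1)) k) → ℕ → ℕ
:= fun k _ N I m => Module.finrank k (Submodule.map (Ideal.Quotient.mkₐ k I).toLinearMap
(MvPolynomial.homogeneousSubmodule (Fin (N + 1)) k m)); let homog : (k : Type) → [Field k] → (N : ℕ)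
→ Ideal (MvPolynomial (Fin (N + 1)) k) → Prop := fun k _ N I => ∀ f ∈ I, ∀ n : ℕ,
MvPolynomial.homogeneousComponent n f ∈ I; let pdeg : (k : Type) → [Field k] → (N : ℕ) → Ideal
(MvPolynomial (Fin (N + 1)) k) → ℕ → Prop := fun k _ N I q => ∀ (L : Type) [Field L] [Algebra k L]
[FiniteDimensional k L], (∃ a : Fin (N + 1) → L, a ≠ 0 ∧ ∀ f ∈ I, MvPolynomial.aeval a f = 0) → q ∣
Module.finrank k L; let bound : ℕ → (k : Type) → [Field k] → (N : ℕ) → Ideal (MvPolynomial (Fin (N +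
1)) k) → Prop := fun p k _ N I => ∀ P : Polynomial ℚ, (∀ᶠ m : ℕ in Filter.atTop, P.eval (m : ℚ) =
(hilb k N I m : ℚ)) → ∀ v : ℕ, pdeg k N I (p ^ v) → ∃ c : ℤ, (p : ℚ) ^ (P.natDegree / (p - 1)) *
P.eval 0 = (p : ℚ) ^ v * (c : ℚ); ∃ p : ℕ, p.Prime ∧ ¬ (∀ (k : Type) [Field k] [CharP k p] (N : ℕ)
(I : Ideal (MvPolynomial (Fin (N + 1)) k)), I.IsPrime → homog k N I → bound p k N I)) ∧ (let hilb :
(k : Type) → [Field k] → (N : ℕ) → Ideal (MvPolynomial (Fin (N + 1)) k) → ℕ → ℕ := fun k _ N I m =>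
Module.finrank k (Submodule.map (Ideal.Quotient.mkₐ k I).toLinearMap
(MvPolynomial.homogeneousSubmodule (Fin (N + 1)) k m)); let homog : (k : Type) → [Field k] → (N : ℕ)
→ Ideal (MvPolynomial (Fin (N + 1)) k) → Prop := fun k _ N I => ∀ f ∈ I, ∀ n : ℕ,
MvPolynomial.homogeneousComponent n f ∈ I; let pdeg : (k : Type) → [Field k] → (N : ℕ) → Ideal
(MvPolynomial (Fin (N + 1)) k) → ℕ → Prop := fun k _ N I q => ∀ (L : Type) [Field L] [Algebra k L]
[FiniteDimensional k L], (∃ a : Fin (N + 1) → L, a ≠ 0 ∧ ∀ f ∈ I, MvPolynomial.aeval a f = 0) → q ∣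
Module.finrank k L; let bound : ℕ → (k : Type) → [Field k] → (N : ℕ) → Ideal (MvPolynomial (Fin (N +
1)) k) → Prop := fun p k _ N I => ∀ P : Polynomial ℚ, (∀ᶠ m : ℕ in Filter.atTop, P.eval (m : ℚ) =
(hilb k N I m : ℚ)) → ∀ v : ℕ, pdeg k N I (p ^ v) → ∃ c : ℤ, (p : ℚ) ^ (P.natDegree / (p - 1)) *
P.eval 0 = (p : ℚ) ^ v * (c : ℚ); let reg : (k : Type) → [Field k] → (N : ℕ) → Ideal (MvPolynomial
(Fin (N + 1)) k) → Prop := fun k _ N I => ∀ (Q : Ideal (MvPolynomial (Fin (N + 1)) k ⧸ I))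
[Q.IsPrime], (∃ i : Fin (N + 1), Ideal.Quotient.mk I (MvPolynomial.X i) ∉ Q) → IsRegularLocalRing
(Localization.AtPrime Q); (∀ p : ℕ, p.Prime → (∀ (k : Type) [Field k] [CharP k p] (N : ℕ) (I : Ideal
(MvPolynomial (Fin (N + 1)) k)), I.IsPrime → homog k N I → reg k N I → bound p k N I)) →
_root_.ResolutionOfSingularities → ∀ p : ℕ, p.Prime → (∀ (k : Type) [Field k] [CharP k p] (N : ℕ) (I
: Ideal (MvPolynomial (Fin (N + 1)) k)), I.IsPrime → homog k N I → bound p k N I))`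

## Assembly
Pure logic, certified sorry-free (Sketch.lean = glue.lean: lean check rc 0, 0 sorries, axioms
propext · Classical.choice · Quot.sound):
assume the summit S; the bridge D applied to the support R and S gives the bound in every prime
characteristic; the certificate W
exhibits p prime with the bound failing at p — contradiction. `closes hW hR hD := fun hS => let ⟨p,
hp, hnot⟩ := hW; hnot (hD hR hS p hp)`.
Every binder is load-bearing (W: the witness; R: hypothesis of D; D: the implication).

Rationale: WHY THIS LINE. MECHANISM = an ARITHMETIC SHADOW of resolution with a finite certificate. A
resolution is a regular alteration of degree 1, so the summit
implies Haution's p-integrality of the homological Chern character in ALL codimensions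
(arXiv:1103.4084 Thm 3.1 proves exactly this from
Gabber's prime-to-p regular alterations, available only in characteristic ≠ p; arXiv:1006.1480 Def.
5.5 names the missing hypothesis
"p-resolution of singularities"; Temkin arXiv:1508.06255 reaches only p-POWER degrees), whence the
Todd–index bound for every projective
variety over every field of characteristic p — tight on degree-p Severi–Brauer varieties and
unconditionally known only for dim X < p(p−1)
(Haution) or dim X ≤ 3 (Lipman1978 / CossartPiltant2019 feed the λ = 1 argument). Contrapositively
ONE violator — finite data: a
Gröbner basis (Hilbert polynomial) and an index lemma (points of X split r generic degree-p symbol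
algebras, whose tensor product is a
division algebra, so p^r | every point degree) — refutes resolution in that characteristic. First
open instances: p = 2, dim X = 4,
X ⊂ C_1×…×C_6 (generic quaternion conics over F_2(a,b), index 64) of codimension 2 and NOT lci with
χ(O_X) ≢ 0 mod 4 (lci, smooth and
Cohen–Macaulay codimension-2 subvarieties are protected: HRR resp. Hilbert–Burch parity — checked by
hand); p = 3, dim 6–7 inside four
generic cubic Severi–Brauer surfaces. Imported areas: Riemann–Roch without denominators / K-theory
of coherent sheaves (Fulton1998 Ch. 18,
Haution), index theory of varieties and central simple algebras (Gabber–Liu–Lorenzini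
arXiv:1209.2828, Merkurjev–Karpenko
incompressibility), motivic operations AT the characteristic (Annala–Elmanto arXiv:2506.05585, who
note that resolution would give the
Steenrod property for smooth schemes). What no listed route does: the two negative routes certify
infinitely many non-ruled divisorial
places (RuledResidues) or a valuative wild-purity symbol (WildPurity) — neither is a finite
computation; the four computational-witness
routes certify termination of the isolated atom dynamics (positive side); no route or negative uses
the index, χ(O_X) or Riemann–Roch.

RANKED CRUXES. #2 NotToddIndexBound (crux) — THE CERTIFICATE — there are a prime p, a field k of
characteristic p and a homogeneous prime I ⊂ k[x_0..x_N] such that X = Proj(k[x]/I) violates the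
Todd–index bound: for the Hilbert polynomial P of k[x]/I and some v with p^v dividing the degree
[L:k] of every finite extension L/k carrying a non-zero zero of I, p^⌊deg P/(p−1)⌋·P(0) is not p^v
times an integer (v_p(n_X) > ⌊dim X/(p−1)⌋ + v_p(χ(X,O_X))). Census plan (kit, one batched job per
family): multigraded ideals of 4-dimensional non-lci subschemes of the Segre product of six generic
conics over F_2(a_1..b_6) (images of finite maps, degeneracy loci of Frobenius-twisted bundle maps,
non-CM codimension-2/3 ideals), Hilbert polynomial mod 4; then dim 6–7 subvarieties of four generic
cubic Severi–Brauer surfaces (p = 3). [difficulty: open-problem] (why it might fail: expected FALSE: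
Haution conjectures the bound in char p too; it is a theorem for dim X < p(p−1) and, via resolution
of ≤3-folds, for dim X ≤ 3; the first family may be "protected" by K_0 of twisted flag varieties
(Quillen–Panin + gamma filtration), forcing evenness algebraically.) [arXiv:1103.4084,
arXiv:1006.1480, arXiv:1209.2828, arXiv:2506.05585, Fulton1998]
#3 ResolutionToToddIndex (crux) — THE BRIDGE — Riemann–Roch without denominators for regular
embedded projective varieties in every prime characteristic (the support item) together with the
summit imply the Todd–index bound for every embedded integral projective variety over every field of
every prime characteristic p: resolve X and all its subvarieties (summit), compare χ(O_X) with
χ(O_X') through π_*O_X'/O_X and the R^iπ_*O_X' (supported in dimension ≤ dim X − 1, handled by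
G_0-dévissage [F] = Σ m_j [O_Z_j] and induction on dimension, n_X | n_Z_j), and bound the top term
by n_X | n_X' | τ_d·χ(O_X') (τ_d's p-part is p^⌊d/(p−1)⌋) — Haution 2012 Thm 3.1 with λ = 1. [deps:
RegularModelsToddIndex] [difficulty: L] (why it might fail: the summit yields PROPER, maybe
non-projective regular models, not smooth over imperfect k; τ_d·χ(O) ∈ n·ℤ for regular complete
non-projective schemes over imperfect fields is not in print (Fulton 18.3 lci-RR wants an embedding
in a smooth k-scheme); perfect k is fine.) [arXiv:1103.4084, Fulton1998, arXiv:1209.2828,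
Kollar2007]
#9 RegularModelsToddIndex (support) — Riemann–Roch WITHOUT DENOMINATORS for regular embedded
projective varieties (known): if Proj(k[x]/I) is regular (every localisation of k[x]/I at a prime
not containing all variables is a regular local ring) then it satisfies the Todd–index bound at
every prime p = char k — X → Spec k is lci with a global factorisation through P^N, τ_X(O_X) =
td(T^vir) ∩ [X] (Fulton 18.3), τ_d·td_d is an integral polynomial in Chern classes of two bundles,
so τ_d·χ(O_X) is the degree of an integral 0-cycle, divisible by n_X (Haution 2012 Prop. 3 + Lemma
on Todd numbers). [difficulty: XL] [arXiv:1103.4084, Fulton1998]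

TWO-LAYER PLAN. Foreseen glued splits (BC3 skeletons checked rc 0 with sorries = stubs, planner
folder bc/): NotToddIndexBound ⇐ GenericConicsIndex
(TRUE, XL: common splitting fields of r generic quaternion algebras over F_2(a,b) have degree
divisible by 2^r — ⊗[a_i,b_i) is a division
algebra) → Hunt (OPEN: a homogeneous prime over F_2(a,b) whose points split all r conics and whose
Hilbert polynomial P has 2^(r−deg P) ∤ P(0))
→ NotToddIndexBound (composition proved). ResolutionToToddIndex ⇐ PerfectFields (true on paper given
S: regular = smooth, HRR for smooth
complete varieties, dévissage) → ImperfectFields (the Riemann–Roch wrinkle for regular complete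
non-projective models) → ResolutionToToddIndex
(case split on PerfectField k, proved).

KILL CRITERIA. A PROOF of the Todd–index bound in characteristic p in all dimensions (e.g.
p-integrality of the homological Chern character for singular
F_p-varieties from power operations at the characteristic — Annala–Elmanto arXiv:2506.05585 /
Elmanto–Morrow motivic cohomology — or a
prime-to-p regular alteration theorem) refutes NotToddIndexBound: close `refuted:NotToddIndexBound`;
the bound then lands as a Literature fact
and a LADDER rung (weakest-known consequence family of the summit). A proof restricted to
subvarieties of projective homogeneous varieties
kills only the first census family: pivot the hunt to non-homogeneous carriers (products of generic
cubic surfaces, p = 3; norm hypersurfaces).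
ResolutionToToddIndex refuted (a regular complete scheme over an imperfect field with τ_d χ(O) ∉ n
ℤ) would itself be a remarkable
Riemann–Roch pathology: pivot the bridge to "resolution by PROJECTIVE morphisms" (what every blow-up
route delivers) as an explicit conditional.
The summit PROVED (any positive route) moots the route and turns the bridge into a theorem:
Todd–index bound in char p.

NOT DECOMPOSED YET. The census families beyond the first two (norm varieties / hypersurfaces in
generic division algebras, varieties finite over products of
Severi–Brauer varieties, p ≥ 5); the algebraic "protection" question for twisted flag varieties (is
2^(r−d) | χ(x) for every x ∈ G_0(Y_r)_(d),
Y_r = product of r generic conics, a consequence of Quillen's computation of K_0 and the gamma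
filtration?) — a refuter/grounder lookup
(Karpenko, Merkurjev, Panin), not an item; the K-theoretic form of the bridge (p-integrality of ch
on G_0) — Lean has no Chow groups; the
curve case of the bound (index | 2χ = −deg K, proved by hand this session for arbitrary singular
curves) as a BC5-style special case.

CHEAPEST FALSIFIER. LOOKUP first (refuter, one hour): has Haution's p-integrality / Todd–index bound
been PROVED in characteristic p since 2012 in all
codimensions — via Primozic 2020 / Annala–Elmanto 2025 power operations at the characteristic,
Elmanto–Morrow motivic cohomology of singular
schemes, or a p'-alteration theorem? (My searches found only the small-codimension theorem and the
2025 operations paper, which treats SMOOTH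
X and says the Steenrod property there would FOLLOW from resolution.) If yes, NotToddIndexBound is
refuted and the route closes at once
(informative: the rung lands). COMPUTATION second (kit, one batched Macaulay2/Singular job, < 1
core-day): for 200 random non-lci
4-dimensional subschemes X of the Segre product of six generic conics over F_2(a_1,…,b_6)
(function-field coefficients; or over F_2 with
the a_i, b_i as extra variables and generic-fibre Hilbert polynomial), compute the multigraded
Hilbert polynomial and χ(O_X) mod 4; any
X with χ ≢ 0 mod 4 that is geometrically integral is a candidate violator to certify (primality of
I, index lemma).

NUMBERS. Todd numbers τ_d = Π_q q^⌊d/(q−1)⌋ (τ_1 = 2, τ_2 = 12, τ_3 = 24, τ_4 = 720); p-part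
p^⌊d/(p−1)⌋. Known range of the bound: dim X < p(p−1)
unconditionally (Haution 2012: p = 2 ⇒ curves only; p = 3 ⇒ dim ≤ 5), dim X ≤ 3 in every p via
resolution of surfaces/threefolds; every
characteristic ≠ p (Gabber). Tightness: SB(A), deg A = p: dim p−1, index p, χ = 1 (equality);
products keep equality; curves: index | 2g−2.
First open cells: (p, dim) = (2, 4), (2, 5), (3, 6), (3, 7), (5, 20). Violation inside a product of
r generic conics (p = 2) for X of
dimension d ⟺ v_2(χ(O_X)) < r − d; lci ⇒ never; CM codim 2 ⇒ χ ≡ 2(P−Q) ≡ 0 mod 4 (Hilbert–Burch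
parity) ⇒ never for r − d = 2. Items at open: 4 (3 + the Assembly item).

DEFINITION REQUESTS. None. Everything is typed scheme-free over Mathlib
(MvPolynomial.homogeneousSubmodule / homogeneousComponent, Module.finrank,
MvPolynomial.aeval, IsRegularLocalRing, Localization.AtPrime) inside the items via `let`; a later
Theorems/ToddIndexDefs.lean may name
hilbFun / PointDegreesDivisibleBy / ToddIndexBoundFor / ProjIsRegular (the Sketch's readable forms,
Iff.rfl-equivalent to the items).
Cite facts wanted (not blocking): Haution 2012 Prop. 3 / Thm 3.1 (Riemann–Roch without denominators;
p-integrality from p'-alterations).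

Novelty: Searches (2026-08-17): `lit frontier ResolutionOfSingularities --since 2023` (30 rows; noted
arXiv:2602.06553, arXiv:2602.14266,
arXiv:2303.18085 — none on index/Riemann–Roch); `lit search "alteration degree prime to p regular
positive characteristic Gabber Temkin"`
(local 1 + crossref noise); `lit search --source zbmath "alterations prime to p"` (15: Orgogozo 2003
prime-to-p π₁, Temkin 2017, Kelly ldh,
Haution 2012 integrality — the find); `lit search --source zbmath "Haution Steenrod operations Chow
groups characteristic resolution"` (2:
arXiv:1307.5628, arXiv:1006.1480); `lit search --source zbmath "Haution"` (12) and "Steenrod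
operations motivic cohomology characteristic p
Primozic" (3: Primozic 2020, Annala–Elmanto arXiv:2506.05585, Primozic 2022); `lit search --source
zbmath "index of an algebraic variety
Gabber Liu Lorenzini"` (3); `lit galaxy search "alteration of degree prime to p" --star all` (0),
"degree prime to the characteristic"
--star all (8, irrelevant); `lit read` of arXiv:1508.06255 (intro), arXiv:1006.1480 (pp. 3, 9),
arXiv:1103.4084 (pp. 3–5, 8, 16–17),
arXiv:2506.05585 (abstract, §4.1–4.2), arXiv:1209.2828 (intro); all 36 open route theses +
RuledResidues/WildPurity files; 75 open cards
(igusa-zeta-certificate, irregularity-budget, certify-monsters, k-regularity-vorst read: none uses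
index / χ(O_X) / Riemann–Roch);
`ledger negatives` (2: ShadowGameWin, DefectlessFrames — unrelated).
Nearest prior art found: arXiv:1103.4084 (Haution 2012: the bound as Sta  [refs: 2602.06553, 2602.14266, 2303.18085, 1307.5628, 1006.1480, 2506.05585, 1508.06255, 1103.4084, 1209.2828]

Barriers (technique_class: refutation-certificate, riemann-roch-integrality, index): - technique_class: refutation-certificate, riemann-roch-integrality, index
- Literature.Barriers.ResolutionOfSingularities.InseparableBaseChange: MET HEAD-ON and confined:
over imperfect k a regular model is not smooth, so the bridge uses lci Riemann–Roch (regular ⇒ lci)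
instead of HRR — this is exactly crux ResolutionToToddIndex's wrinkle for non-projective models;
over perfect fields it does not bite.
- Literature.Barriers.ResolutionOfSingularities.RegularNotGeometricallyRegular: same scope remark —
the bound and the certificate are stated with REGULAR (not smooth) models and with the index over k,
never after base change (p-adic index information dies under purely inseparable base change).
- Literature.Barriers.ResolutionOfSingularities.DimensionFourFrontier: not a technique barrier for
this line (no induction on dimension through LU/patching); it LOCATES the hunt: the bound is a
theorem up to dimension 3 by the same dévissage, so violators live in dimension ≥ 4 (p = 2) — the
summit's open range.
- Literature.Barriers.ResolutionOfSingularities.Hauser2003_kangarooShadeIncrease: not applicable —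
no blow-up invariant, no maximal contact, no centre is ever chosen; likewise the residual-order /
Narasimhan / directrix / Artin–Schreier–Puiseux / local-monomialisation (Cutkosky2014) /
quasi-excellence entries of the catalogue (invariant, valuation and monomialisation classes;
everything here is of finite type over a field).
- Literature.Barriers.ResolutionOfSingularities.Cutkosky2

History (route lifecycle, newest last):
- 2026-08-24T19:39:41Z · DORMANT — reconciler: no traction for 7 d (last activity statement-grounded at 2026-08-17T18:38:52Z); parked, not closed — `ledger route dormant route-ResolutionOfSingula (operator:999:2356009)

sub-problem: ResolutionOfSingularities · status: dormant · opened planner-plan-novel-ResolutionOfSingularities-Re-dc19aa3a-d-v2-g31-0 2026-08-17T14:33:01Z · rev 0 · ledger route-ResolutionOfSingularities-ToddIndex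
GENERATED by the gate from the ledger (D-0016/17). Provers cite these decls: `theorem foo : Summit.ResolutionOfSingularities.ResolutionOfSingularities.Theses.ToddIndex.<Decl> := …` in Summits/ResolutionOfSingularities/ResolutionOfSingularities/Theorems/<Name>.lean.
-/

namespace Summit.ResolutionOfSingularities.ResolutionOfSingularities.Theses.ToddIndex

open scoped BigOperators Topology Manifold Classical MeasureTheory ProbabilityTheory Matrix InnerProductSpace ComplexConjugate ContinuousMap
open Filter Set Function TopologicalSpace MeasureTheory

attribute [summit_statement] _root_.ResolutionOfSingularities

/-- item stmt-ResolutionOfSingularities-18202 · crux · rank 2 · open · by planner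
why it might fail: expected FALSE: Haution conjectures the bound in char p too; it is a theorem for dim X < p(p−1) and, via resolution of ≤3-folds, for dim X ≤ 3; the first family may be "protected" by K_0 of twisted flag varieties (Quillen–Panin + gamma filtration), forcing evenness algebraically.
sources: arXiv:1103.4084, arXiv:1006.1480, arXiv:1209.2828, arXiv:2506.05585, Fulton1998
[crux] THE CERTIFICATE — there are a prime p, a field k of characteristic p and a homogeneous prime
I ⊂ k[x_0..x_N] such that X = Proj(k[x]/I) violates the Todd–index bound: for the Hilbert polynomial
P of k[x]/I and some v with p^v dividing the degree [L:k] of every finite extension L/k carrying a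
non-zero zero of I, p^⌊deg P/(p−1)⌋·P(0) is not p^v times an integer (v_p(n_X) > ⌊dim X/(p−1)⌋ +
v_p(χ(X,O_X))). Census plan (kit, one batched job per family): multigraded ideals of 4-dimensional
non-lci subschemes of the Segre product of six generic conics over F_2(a_1..b_6) (images of finite
maps, degeneracy loci of Frobenius-twisted bundle maps, non-CM codimension-2/3 ideals), Hilbert
polynomial mod 4; then dim 6–7 subvarieties of four generic cubic Severi–Brauer surfaces (p = 3).
[difficulty: open-problem] -/
@[route_item "route-ResolutionOfSingularities-ToddIndex", crux]
def NotToddIndexBound : Prop :=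
  let hilb : (k : Type) → [Field k] → (N : ℕ) → Ideal (MvPolynomial (Fin (N + 1)) k) → ℕ → ℕ := fun k _ N I m => Module.finrank k (Submodule.map (Ideal.Quotient.mkₐ k I).toLinearMap (MvPolynomial.homogeneousSubmodule (Fin (N + 1)) k m)); let homog : (k : Type) → [Field k] → (N : ℕ) → Ideal (MvPolynomial (Fin (N + 1)) k) → Prop := fun k _ N I => ∀ f ∈ I, ∀ n : ℕ, MvPolynomial.homogeneousComponent n f ∈ I; let pdeg : (k : Type) → [Field k] → (N : ℕ) → Ideal (MvPolynomial (Fin (N + 1)) k) → ℕ → Prop := fun k _ N I q => ∀ (L : Type) [Field L] [Algebra k L] [FiniteDimensional k L], (∃ a : Fin (N + 1) → L, a ≠ 0 ∧ ∀ f ∈ I, MvPolynomial.aeval a f = 0) → q ∣ Module.finrank k L; let bound : ℕ → (k : Type) → [Field k] → (N : ℕ) → Ideal (MvPolynomial (Fin (N + 1)) k) → Prop := fun p k _ N I => ∀ P : Polynomial ℚ, (∀ᶠ m : ℕ in Filter.atTop, P.eval (m : ℚ) = (hilb k N I m : ℚ)) → ∀ v : ℕ, pdeg k N I (p ^ v)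 → ∃ c : ℤ, (p : ℚ) ^ (P.natDegree / (p - 1)) * P.eval 0 = (p : ℚ) ^ v * (c : ℚ); ∃ p : ℕ, p.Prime ∧ ¬ (∀ (k : Type) [Field k] [CharP k p] (N : ℕ) (I : Ideal (MvPolynomial (Fin (N + 1)) k)), I.IsPrime → homog k N I → bound p k N I)

/-- item stmt-ResolutionOfSingularities-18203 · crux · rank 3 · open · by planner
why it might fail: the summit yields PROPER, maybe non-projective regular models, not smooth over imperfect k; τ_d·χ(O) ∈ n·ℤ for regular complete non-projective schemes over imperfect fields is not in print (Fulton 18.3 lci-RR wants an embedding in a smooth k-scheme); perfect k is fine.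
sources: arXiv:1103.4084, Fulton1998, arXiv:1209.2828, Kollar2007
[crux] THE BRIDGE — Riemann–Roch without denominators for regular embedded projective varieties in
every prime characteristic (the support item) together with the summit imply the Todd–index bound
for every embedded integral projective variety over every field of every prime characteristic p:
resolve X and all its subvarieties (summit), compare χ(O_X) with χ(O_X') through π_*O_X'/O_X and the
R^iπ_*O_X' (supported in dimension ≤ dim X − 1, handled by G_0-dévissage [F] = Σ m_j [O_Z_j] and
induction on dimension, n_X | n_Z_j), and bound the top term by n_X | n_X' | τ_d·χ(O_X') (τ_d's
p-part is p^⌊d/(p−1)⌋) — Haution 2012 Thm 3.1 with λ = 1. [deps: RegularModelsToddIndex]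
[difficulty: L] -/
@[route_item "route-ResolutionOfSingularities-ToddIndex", crux]
def ResolutionToToddIndex : Prop :=
  let hilb : (k : Type) → [Field k] → (N : ℕ) → Ideal (MvPolynomial (Fin (N + 1)) k) → ℕ → ℕ := fun k _ N I m => Module.finrank k (Submodule.map (Ideal.Quotient.mkₐ k I).toLinearMap (MvPolynomial.homogeneousSubmodule (Fin (N + 1)) k m)); let homog : (k : Type) → [Field k] → (N : ℕ) → Ideal (MvPolynomial (Fin (N + 1)) k) → Prop := fun k _ N I => ∀ f ∈ I, ∀ n : ℕ, MvPolynomial.homogeneousComponent n f ∈ I; let pdeg : (k : Type) → [Field k] → (N : ℕ) → Ideal (MvPolynomial (Fin (N + 1)) k) → ℕ → Prop := fun k _ N I q => ∀ (L : Type) [Field L] [Algebra k L] [FiniteDimensional k L], (∃ a : Fin (N + 1) → L, a ≠ 0 ∧ ∀ f ∈ I, MvPolynomial.aeval a f = 0) → q ∣ Module.finrank k L; let bound : ℕ → (k : Type) → [Field k] → (N : ℕ) → Ideal (MvPolynomial (Fin (N + 1)) k) → Prop := fun p k _ N I => ∀ P : Polynomial ℚ, (∀ᶠ m : ℕ in Filter.atTop,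 P.eval (m : ℚ) = (hilb k N I m : ℚ)) → ∀ v : ℕ, pdeg k N I (p ^ v) → ∃ c : ℤ, (p : ℚ) ^ (P.natDegree / (p - 1)) * P.eval 0 = (p : ℚ) ^ v * (c : ℚ); let reg : (k : Type) → [Field k] → (N : ℕ) → Ideal (MvPolynomial (Fin (N + 1)) k) → Prop := fun k _ N I => ∀ (Q : Ideal (MvPolynomial (Fin (N + 1)) k ⧸ I)) [Q.IsPrime], (∃ i : Fin (N + 1), Ideal.Quotient.mk I (MvPolynomial.X i) ∉ Q) → IsRegularLocalRing (Localization.AtPrime Q); (∀ p : ℕ, p.Prime → (∀ (k : Type) [Field k] [CharP k p] (N : ℕ) (I : Ideal (MvPolynomial (Fin (N + 1)) k)), I.IsPrime → homog k N I → reg k N I → bound p k N I)) → _root_.ResolutionOfSingularities → ∀ p : ℕ, p.Prime → (∀ (k : Type) [Field k] [CharP k p] (N : ℕ) (I : Ideal (MvPolynomial (Fin (N + 1)) k)), I.IsPrime → homog k N I → bound p k N I)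

/-- item stmt-ResolutionOfSingularities-18204 · support · rank 9 · open · by planner
sources: arXiv:1103.4084, Fulton1998
[support] Riemann–Roch WITHOUT DENOMINATORS for regular embedded projective varieties (known): if
Proj(k[x]/I) is regular (every localisation of k[x]/I at a prime not containing all variables is a
regular local ring) then it satisfies the Todd–index bound at every prime p = char k — X → Spec k is
lci with a global factorisation through P^N, τ_X(O_X) = td(T^vir) ∩ [X] (Fulton 18.3), τ_d·td_d is
an integral polynomial in Chern classes of two bundles, so τ_d·χ(O_X) is the degree of an integral
0-cycle, divisible by n_X (Haution 2012 Prop. 3 + Lemma on Todd numbers). [difficulty: XL] -/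
@[route_item "route-ResolutionOfSingularities-ToddIndex", crux]
def RegularModelsToddIndex : Prop :=
  let hilb : (k : Type) → [Field k] → (N : ℕ) → Ideal (MvPolynomial (Fin (N + 1)) k) → ℕ → ℕ := fun k _ N I m => Module.finrank k (Submodule.map (Ideal.Quotient.mkₐ k I).toLinearMap (MvPolynomial.homogeneousSubmodule (Fin (N + 1)) k m)); let homog : (k : Type) → [Field k] → (N : ℕ) → Ideal (MvPolynomial (Fin (N + 1)) k) → Prop := fun k _ N I => ∀ f ∈ I, ∀ n : ℕ, MvPolynomial.homogeneousComponent n f ∈ I; let pdeg : (k : Type) → [Field k] → (N : ℕ) → Ideal (MvPolynomial (Fin (N + 1)) k) → ℕ → Prop := fun k _ N I q => ∀ (L : Type) [Field L] [Algebra k L] [FiniteDimensional k L], (∃ a : Fin (N + 1) → L, a ≠ 0 ∧ ∀ f ∈ I, MvPolynomial.aeval a f = 0) → q ∣ Module.finrank k L; let bound : ℕ → (k : Type) → [Field k] → (N : ℕ) → Ideal (MvPolynomial (Fin (N + 1)) k) → Prop := fun p k _ N I => ∀ P : Polynomial ℚ, (∀ᶠ m : ℕ in Filter.atTop, P.eval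 (m : ℚ) = (hilb k N I m : ℚ)) → ∀ v : ℕ, pdeg k N I (p ^ v) → ∃ c : ℤ, (p : ℚ) ^ (P.natDegree / (p - 1)) * P.eval 0 = (p : ℚ) ^ v * (c : ℚ); let reg : (k : Type) → [Field k] → (N : ℕ) → Ideal (MvPolynomial (Fin (N + 1)) k) → Prop := fun k _ N I => ∀ (Q : Ideal (MvPolynomial (Fin (N + 1)) k ⧸ I)) [Q.IsPrime], (∃ i : Fin (N + 1), Ideal.Quotient.mk I (MvPolynomial.X i) ∉ Q) → IsRegularLocalRing (Localization.AtPrime Q); ∀ p : ℕ, p.Prime → (∀ (k : Type) [Field k] [CharP k p] (N : ℕ) (I : Ideal (MvPolynomial (Fin (N + 1)) k)), I.IsPrime → homog k N I → reg k N I → bound p k N I)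

/-- item stmt-ResolutionOfSingularities-18205 · assembly · rank 1 · open · by planner
sources: arXiv:1103.4084
[assembly] NotToddIndexBound → RegularModelsToddIndex → ResolutionToToddIndex → ¬
ResolutionOfSingularities (refutation shape; the type of the deciding theorem `closes`). -/
@[route_item "route-ResolutionOfSingularities-ToddIndex"]
def Assembly : Prop :=
  NotToddIndexBound → RegularModelsToddIndex → ResolutionToToddIndex → ¬ _root_.ResolutionOfSingularities

/-! D-0027 §2.1 — DECIDING THEOREM (planner-authored via `route open/edit --closes-file`; by planner-plan-novel-ResolutionOfSingularities-Re-dc19aa3a-d-v 2026-08-17T14:33:01Z):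
its hypotheses are this route's items and its conclusion the sub-problem Statement (glue_lint), and it elaborates with this file. -/

@[closes "route-ResolutionOfSingularities-ToddIndex"] theorem closes (hW : NotToddIndexBound) (hR : RegularModelsToddIndex)
    (hD : ResolutionToToddIndex) : ¬ _root_.ResolutionOfSingularities := by
  intro hS
  obtain ⟨p, hp, hnot⟩ := hW
  exact hnot (hD hR hS p hp)

end Summit.ResolutionOfSingularities.ResolutionOfSingularities.Theses.ToddIndex
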